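import Summits.Schanuel.Schanuel.Theorems.DiophantineDichotomyKhovanskiiApproxTypeEvRareFieldDefs
import Literature.NumberTheory.Transcendental.LindemannWeierstrassMeasureHolds
import Summits.Schanuel.Schanuel.Theorems.DiophantineDichotomyKhovanskiiApproxTypeEvSumCompositionClause
import HarnessLib

/-!
# The print baseline of the order-defect measure M2: `κ = n` (`orderDefectMeasure_print`)

Line `Sketch` of crux `DiophantineDichotomy.KhovanskiiApproxTypeEv` (stmt-Schanuel-14972), skeleton v10
(lead `prover-line-stmt-Schanuel-14972-c12-0`) — `--supports`.

STRATEGY-CENSUS §7 (crux-strategist) locates the open content of leaf B (`stub_evLW_rankThreeUp`, the naive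
Lindemann–Weierstrass layer at rank `≥ 3`) in a DEGREE-ASPECT sharpening "M2" of the transcendence measure of ONE
value `η = Σ_j e^{β_j}` of an order-`n` exponential sum at `ℚ`-linearly independent algebraic frequencies:
`OrderDefectMeasure n κ : ∀ β, ∃ C > 0 ∀ D ∃ H₀ ∀ H ≥ H₀ ∀ P ∈ ℤ[x]∖0 (deg ≤ D, ‖P‖_∞ ≤ H):
|P(η)| ≥ exp(−C D^κ log H)` (typed in `Cruxes/KhovanskiiApproxTypeEv/SketchIdea.lean`), needed with `κ < n − 1/2`,
"KNOWN with `κ = n`".  This file makes the known end a KERNEL theorem, stated with the definition unfolded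
(`stub_orderDefectMeasurePrint`, alias `orderDefectMeasure_print`): Ably 1994 (PROVED in the tree, `Ably1994_lindemannWeierstrass_measure_holds`, p121092)
at `m = n` applied to `Q := P ∘ (x₁ + ⋯ + xₙ) ∈ ℤ[x₁, …, xₙ]` — total degree `≤ D`, naive height `≤ n^D (D+1) H`
(`stub_sumCompositionClause`: multinomial coefficients `≤ n^j`), `Q ≠ 0` (`Q(t, 0, …, 0) = P(t)`), and the penalty
`exp(C Dⁿ log(D+1))` together with `log(n^D (D+1))` absorbed by the threshold `H₀(D)`.  Everything here is proved;
no named facts.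
-/

noncomputable section

set_option linter.dupNamespace false -- mandated summit/sub-problem namespace (single-conjunct summit)

namespace Summit.Schanuel.Schanuel.Cruxes.KhovanskiiApproxTypeEv.AnchoredReduction

open Literature.NumberTheory.Transcendental (Ably1994_lindemannWeierstrass_measure_holds)
open Polynomial

/-- **`stub_orderDefectMeasurePrint` — M2 WITH THE PRINT EXPONENT `κ = n`** (registered sub-goal F of line `Sketch`,
skeleton v10; lead c12) (= `OrderDefectMeasure n n` of
`Cruxes/KhovanskiiApproxTypeEv/SketchIdea.lean`, unfolded): for `ℚ`-linearly independent algebraic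
`β₁, …, βₙ` (`n ≥ 1`) there is `C > 0` such that for every degree budget `D`, beyond a threshold `H₀(D)`, every
non-zero `P ∈ ℤ[x]` of degree `≤ D` and naive height `≤ H` satisfies
`|P(e^{β₁} + ⋯ + e^{βₙ})| ≥ exp(−C Dⁿ log H)`.  Ably 1994 at `m = n` on `P ∘ (x₁ + ⋯ + xₙ)`; leaf B of the crux
would need the same with an exponent `< n − 1/2` on `D` (STRATEGY-CENSUS §7, not in print).
[cite: Ably1994, Théorème p. 30] -/
theorem stub_orderDefectMeasurePrint (n : ℕ) (hn : 1 ≤ n) (β : Fin n → ℂ) (halg : ∀ j, IsAlgebraic ℚ (β j))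
    (hli : LinearIndependent ℚ β) :
    ∃ C : ℝ, 0 < C ∧ ∀ D : ℕ, ∃ H₀ : ℕ, ∀ (H : ℕ) (P : Polynomial ℤ), H₀ ≤ H → P ≠ 0 →
      P.natDegree ≤ D → (∀ k, |P.coeff k| ≤ (H : ℤ)) →
        Real.exp (-(C * (D : ℝ) ^ (n : ℝ) * Real.log H)) ≤
          ‖Polynomial.aeval (∑ j, Complex.exp (β j)) P‖ := by
  obtain ⟨CA, c₂, hCA, hc₂, hably⟩ := Ably1994_lindemannWeierstrass_measure_holds n β halg hli
  refine ⟨3 * c₂, by positivity, fun D => ?_⟩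
  -- thresholds: `H ≥ n^D (D+1)`, `log H ≥ exp(C Dⁿ log(D+1))`, `H ≥ 3`
  set T : ℕ := n ^ D * (D + 1) with hT
  set pen : ℝ := Real.exp (CA * (D : ℝ) ^ n * Real.log ((D : ℝ) + 1)) with hpen
  refine ⟨max (max T ⌈Real.exp pen⌉₊) 3, fun H P hH hP0 hPdeg hPH => ?_⟩
  have hTH : T ≤ H := le_trans (le_trans (le_max_left _ _) (le_max_left _ _)) hH
  have hEH : ⌈Real.exp pen⌉₊ ≤ H := le_trans (le_trans (le_max_right _ _) (le_max_left _ _)) hH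
  have hH3 : 3 ≤ H := le_trans (le_max_right _ _) hH
  have hT1 : 1 ≤ T := by
    rw [hT]; exact Nat.one_le_iff_ne_zero.2 (by positivity)
  have hHr : (3 : ℝ) ≤ H := by exact_mod_cast hH3
  have hHpos : (0 : ℝ) < H := by linarith
  have hTr : (1 : ℝ) ≤ T := by exact_mod_cast hT1
  have hTpos : (0 : ℝ) < T := by linarith
  have hlogH1 : 1 ≤ Real.log H := by
    rw [Real.le_log_iff_exp_le hHpos]
    have := Real.exp_one_lt_d9
    linarith
  have hlogH0 : 0 ≤ Real.log H := by linarith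
  -- the composed polynomial and Ably's measure at level `(D, T H)`
  obtain ⟨Q, hQ0, hQdeg, hQcoeff, hQeval⟩ := stub_sumCompositionClause n D H hn P hP0 hPdeg hPH
  have hQcoeff' : ∀ m, |Q.coeff m| ≤ ((T * H : ℕ) : ℤ) := fun m => by
    simpa [hT, mul_assoc] using hQcoeff m
  have hmeas := hably Q D (T * H) hQ0 hQdeg hQcoeff'
  rw [hQeval] at hmeas
  refine le_trans (Real.exp_le_exp.2 (neg_le_neg ?_)) hmeas
  -- `c₂ Dⁿ (log (T H) + pen) ≤ 3 c₂ Dⁿ log H`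
  have hlogTH : Real.log ((T * H : ℕ) : ℝ) ≤ 2 * Real.log H := by
    push_cast
    rw [Real.log_mul hTpos.ne' hHpos.ne']
    have : Real.log T ≤ Real.log H := Real.log_le_log hTpos (by exact_mod_cast hTH)
    linarith
  have hpenH : pen ≤ Real.log H := by
    rw [Real.le_log_iff_exp_le hHpos]
    exact (Nat.le_ceil _).trans (by exact_mod_cast hEH)
  have hDn : (D : ℝ) ^ (n : ℝ) = (D : ℝ) ^ n := Real.rpow_natCast _ _
  have hDn0 : 0 ≤ (D : ℝ) ^ n := by positivity
  rw [hDn]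
  have key : Real.log ((T * H : ℕ) : ℝ) + pen ≤ 3 * Real.log H := by linarith
  calc c₂ * (D : ℝ) ^ n * (Real.log ((T * H : ℕ) : ℝ) +
        Real.exp (CA * (D : ℝ) ^ n * Real.log ((D : ℝ) + 1)))
      = c₂ * (D : ℝ) ^ n * (Real.log ((T * H : ℕ) : ℝ) + pen) := by rw [hpen]
    _ ≤ c₂ * (D : ℝ) ^ n * (3 * Real.log H) :=
        mul_le_mul_of_nonneg_left key (by positivity)
    _ = 3 * c₂ * (D : ℝ) ^ n * Real.log H := by ring

/-- Alias of `stub_orderDefectMeasurePrint` under its natural name: the order-defect measure M2 holds with the print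
exponent `κ = n` at every rank `n ≥ 1`. [cite: Ably1994, Théorème p. 30] -/
theorem orderDefectMeasure_print (n : ℕ) (hn : 1 ≤ n) (β : Fin n → ℂ) (halg : ∀ j, IsAlgebraic ℚ (β j))
    (hli : LinearIndependent ℚ β) :
    ∃ C : ℝ, 0 < C ∧ ∀ D : ℕ, ∃ H₀ : ℕ, ∀ (H : ℕ) (P : Polynomial ℤ), H₀ ≤ H → P ≠ 0 →
      P.natDegree ≤ D → (∀ k, |P.coeff k| ≤ (H : ℤ)) →
        Real.exp (-(C * (D : ℝ) ^ (n : ℝ) * Real.log H)) ≤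
          ‖Polynomial.aeval (∑ j, Complex.exp (β j)) P‖ :=
  stub_orderDefectMeasurePrint n hn β halg hli

/-- Rank 3 (the rank of leaf B's located problem): `|P(e^{s₀} + e^{s₁} + e^{s₂})| ≥ exp(−C D³ log H)` eventually in
`H`, at every LW triple — print `κ = 3`; leaf B would need `κ < 5/2` (STRATEGY-CENSUS §7.1; certificate p146020 is the
simultaneous-approximation shadow of the same gap). [folklore] -/
theorem orderDefectMeasure_print_three (s : Fin 3 → ℂ) (halg : ∀ j, IsAlgebraic ℚ (s j))
    (hli : LinearIndependent ℚ s) :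
    ∃ C : ℝ, 0 < C ∧ ∀ D : ℕ, ∃ H₀ : ℕ, ∀ (H : ℕ) (P : Polynomial ℤ), H₀ ≤ H → P ≠ 0 →
      P.natDegree ≤ D → (∀ k, |P.coeff k| ≤ (H : ℤ)) →
        Real.exp (-(C * (D : ℝ) ^ (3 : ℝ) * Real.log H)) ≤
          ‖Polynomial.aeval (∑ j, Complex.exp (s j)) P‖ := by
  have h := stub_orderDefectMeasurePrint 3 (by norm_num) s halg hli
  have h3 : ((3 : ℕ) : ℝ) = (3 : ℝ) := by norm_num
  rw [h3] at h
  exact h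

end Summit.Schanuel.Schanuel.Cruxes.KhovanskiiApproxTypeEv.AnchoredReduction

end
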